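import Literature.Topology.FourManifolds.SchoenfliesBallSide
import HarnessLib

/-!
# A regular sublevel set of Euclidean space which is a smooth ball is a smoothly embedded ball

Topic `Literature/Topology/FourManifolds`; the Euclidean twin of §4 of `SchoenfliesBallSide.lean`
(`SphereHypersurfaceSides.IsSidePackage.exists_ball_of_diffeomorph_regularSublevel`: a closed side
of a hypersurface sphere in `𝕊 (m+1)` which is diffeomorphic to the disc is a smoothly embedded
ball), written for the fact seat of
`Literature.Topology.FourManifolds.Trisection.isConnectedSum_of_reducing_separating`
(`ReducibleTrisectionSplitting.lean`, § Status, road (P1′), route M): there the core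
`Z₀ = {G₀ ≤ 0} ⊂ ℝ⁴` of a cut `1`-handlebody is recognised as a `4`-ball by handle cancellation
and the classification of `1`-handlebodies (an abstract diffeomorphism `Z₀ ≅ 𝔻⁴`), and what is
consumed afterwards is the **embedded** form: a smooth embedding `E : ℝ⁴ → ℝ⁴` with
`E(𝕊³) = ∂Z₀ = G₀⁻¹(0)` and `E(𝔻⁴) = Z₀` (it carries the radial bicollar of `𝕊³` to a bicollar
of the level, and Alexander's theorem from `𝕊³` to spheres in the level).

* `RegularSublevel.image_incl_symm_norm_eq_one`: for a regular sublevel set `W = {G ≤ c}` of a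
  smooth function on `ℝⁿ⁺¹` and a diffeomorphism `Ψ : W ≅ 𝔻ⁿ⁺¹` of manifolds with boundary,
  `ι_W (Ψ⁻¹ (∂𝔻ⁿ⁺¹)) = G⁻¹(c)` (invariance of the boundary, `BoundaryData.restrictDiffeomorph`);
* `RegularSublevel.exists_ball_of_diffeomorph_closedBall` (**main**): there is a smooth embedding
  `e : ℝⁿ⁺¹ → ℝⁿ⁺¹` with `e(𝕊ⁿ) = G⁻¹(c)`, `e(𝔻ⁿ⁺¹) = {G ≤ c}` and `e(𝔹ⁿ⁺¹) = {G < c}` — read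
  `ι_W ∘ Ψ⁻¹ : 𝔻ⁿ⁺¹ → ℝⁿ⁺¹` and extend it by
  `ClosedDiscExtension.exists_isSmoothEmbedding_extension` (Seeley extension, inverse function
  theorem, injectivity near a compact set, radial squeeze; Hirsch, Ch. 2 §1, Exercise 7).

Everything is **proved**; no definition, no named fact.

## References
* M. W. Hirsch, *Differential Topology*, GTM 33 (1976), Ch. 2 §1, Exercise 7; Ch. 8 §3
  (discs). [HirschDT1976]
* J. Milnor, *Morse theory* (1963), Thm. 3.1 (`Mᵃ` is a smooth manifold with boundary `f⁻¹(a)`).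
  [Milnor1963]
-/

open scoped Manifold ContDiff Topology
open Set Function Metric Module Filter

noncomputable section

namespace Literature.Topology.FourManifolds

/-- Local notation: `𝔼 n` is the model Euclidean space `EuclideanSpace ℝ (Fin n)`. -/
local notation "𝔼 " n:arg => EuclideanSpace ℝ (Fin n)

/-- Local notation: `𝕊 n` is the unit sphere in `EuclideanSpace ℝ (Fin (n + 1))`. -/
local notation "𝕊 " n:arg => (Metric.sphere (0 : EuclideanSpace ℝ (Fin (n + 1))) 1)

/-- Local notation: `𝔻 n` is the closed unit ball in `EuclideanSpace ℝ (Fin n)`. -/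
local notation "𝔻 " n:arg => (Metric.closedBall (0 : EuclideanSpace ℝ (Fin n)) 1)

namespace RegularSublevel

variable {n : ℕ} {G : 𝔼 (n + 1) → ℝ} {c : ℝ}

/-- **The ball diffeomorphism matches the boundary sphere with the level**: for a diffeomorphism
`Ψ : W ≅ 𝔻ⁿ⁺¹` of the regular sublevel set `W = {G ≤ c}`, `ι_W (Ψ⁻¹ (∂𝔻ⁿ⁺¹)) = G⁻¹(c)`
(invariance of the boundary under diffeomorphisms, `BoundaryData.restrictDiffeomorph`).
[cite: Milnor1963, Thm. 3.1] -/
theorem image_incl_symm_norm_eq_one (h : IsRegularLevel (𝓡 (n + 1)) G c)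
    (Ψ : RegularSublevel h ≃ₘ⟮𝓡∂ (n + 1), 𝓡∂ (n + 1)⟯ 𝔻 (n + 1)) :
    (incl h ∘ Ψ.symm) '' {x | ‖(x : 𝔼 (n + 1))‖ = 1} = G ⁻¹' {c} := by
  haveI : Fact (isSmoothEmbedding_sphereInclusion' n) := ⟨isSmoothEmbedding_sphereInclusion'_holds n⟩
  ext y
  constructor
  · rintro ⟨x, hx, rfl⟩
    have hx' : (x : 𝔼 (n + 1)) ∈ sphere (0 : 𝔼 (n + 1)) 1 := mem_sphere_zero_iff_norm.2 hx
    have key := BoundaryData.incl_restrictDiffeomorph (b₁ := closedBallBoundaryData n)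
      (b₂ := boundaryData h) Ψ.symm ⟨x, hx'⟩
    rw [boundaryData_incl, closedBallBoundaryData_incl] at key
    have hxe : Set.inclusion sphere_subset_closedBall (⟨(x : 𝔼 (n + 1)), hx'⟩ : 𝕊 n) = x :=
      Subtype.ext rfl
    rw [hxe] at key
    show G (incl h (Ψ.symm x)) = c
    rw [← key]
    exact apply_incl_boundary h _
  · intro hy
    have hy0 : G y = c := hy
    have hbd : RegularSublevel.mk h y hy0.le ∈ (𝓡∂ (n + 1)).boundary (RegularSublevel h) :=
      (mem_boundary_iff h _).2 hy0
    set z : 𝕊 n := (boundaryData h).restrictDiffeomorph (closedBallBoundaryData n) Ψ ⟨_, hbd⟩ with hz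
    have key := BoundaryData.incl_restrictDiffeomorph (b₁ := boundaryData h)
      (b₂ := closedBallBoundaryData n) Ψ ⟨_, hbd⟩
    rw [boundaryData_incl, closedBallBoundaryData_incl, ← hz] at key
    refine ⟨Set.inclusion sphere_subset_closedBall z, by simp [norm_eq_of_mem_sphere z], ?_⟩
    show incl h (Ψ.symm (Set.inclusion sphere_subset_closedBall z)) = y
    change Set.inclusion sphere_subset_closedBall z = Ψ (RegularSublevel.mk h y hy0.le) at key
    rw [key, Diffeomorph.symm_apply_apply, incl_mk]

/-- **A regular sublevel set of `ℝⁿ⁺¹` which is a smooth ball is a smoothly embedded ball.**  If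
`W = {G ≤ c}` (a regular sublevel set of a smooth function on `ℝⁿ⁺¹`, as a manifold with
boundary) is diffeomorphic to the closed disc `𝔻ⁿ⁺¹`, then there is a smooth embedding
`e : ℝⁿ⁺¹ → ℝⁿ⁺¹` of all of Euclidean space with `e(𝕊ⁿ) = G⁻¹(c)`, `e(𝔻ⁿ⁺¹) = {G ≤ c}` and
`e(𝔹ⁿ⁺¹) = {G < c}`.  Proof: extend the closed-disc embedding `ι_W ∘ Ψ⁻¹`
(`ClosedDiscExtension.exists_isSmoothEmbedding_extension`); the three images by invariance of the
boundary and injectivity. [cite: HirschDT1976, Ch. 2 §1, Exercise 7] -/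
theorem exists_ball_of_diffeomorph_closedBall (h : IsRegularLevel (𝓡 (n + 1)) G c)
    (Ψ : RegularSublevel h ≃ₘ⟮𝓡∂ (n + 1), 𝓡∂ (n + 1)⟯ 𝔻 (n + 1)) :
    ∃ e : 𝔼 (n + 1) → 𝔼 (n + 1), Manifold.IsSmoothEmbedding (𝓡 (n + 1)) (𝓡 (n + 1)) ∞ e ∧
      e '' sphere 0 1 = G ⁻¹' {c} ∧ e '' closedBall 0 1 = {z | G z ≤ c} ∧
        e '' ball 0 1 = {z | G z < c} := by
  haveI : CompactSpace (𝔻 (n + 1)) := isCompact_iff_compactSpace.1 (isCompact_closedBall _ _)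
  set j : (𝔻 (n + 1)) → 𝔼 (n + 1) := incl h ∘ Ψ.symm with hjdef
  have hj : Manifold.IsSmoothEmbedding (𝓡∂ (n + 1)) (𝓡 (n + 1)) ∞ j :=
    (isSmoothEmbedding_incl h).comp_diffeomorph Ψ.symm
  have hrange : range j = {z | G z ≤ c} := by
    have hs : Surjective (⇑Ψ.symm) := Ψ.symm.surjective
    rw [hjdef, hs.range_comp, range_incl]; rfl
  obtain ⟨e, he, hsph, hcl, -⟩ := ClosedDiscExtension.exists_isSmoothEmbedding_extension (n := n)
    (E' := 𝔼 (n + 1)) finrank_euclideanSpace_fin hj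
  have hsph' : e '' sphere 0 1 = G ⁻¹' {c} := by rw [hsph, hjdef]; exact image_incl_symm_norm_eq_one h Ψ
  have hcl' : e '' closedBall 0 1 = {z | G z ≤ c} := by rw [hcl, hrange]
  refine ⟨e, he, hsph', hcl', ?_⟩
  rw [← closedBall_sdiff_sphere, image_sdiff he.isEmbedding.injective, hcl', hsph']
  ext z
  simp only [Set.mem_sdiff, mem_setOf_eq, mem_preimage, mem_singleton_iff]
  exact ⟨fun ⟨h1, h2⟩ => lt_of_le_of_ne h1 h2, fun hz => ⟨hz.le, hz.ne⟩⟩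

end RegularSublevel

end Literature.Topology.FourManifolds
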